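import Summits.QuantumFields.YangMills.Theorems.BalabanLadderUVSeamRecClassicalResponseTempering
import Literature.MathematicalPhysics.QuantumFieldTheory.Balaban1983to89.T3DescentFibreTower
import HarnessLib

/-!
# Crux `UVSeamRec` (stmt-QuantumFields-20043): the identity exterior under the (β) architecture —
# it is never flagged, its classical carrier vanishes, and every (split) forces the DIRICHLET RATE LAW

Helper file (`--supports stmt-QuantumFields-20043`) of the unit `ym-20043-tempered-d1` (gen 2); sequel of
`…ClassicalResponseTempering` (p554899).  Currency: the unit's D1 files (p531519 `blockField` / `largeFieldEvent` / `influence`),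
the LEAD's p546887 (`classicalResponse`, `carrierCl`) and p548409 (`SplitCl`, `BackgroundFieldSU2`), and p554899 (`PureSplitCl`,
`PureSplitClSU2`, `BackgroundFieldBoundedSU2`).

WHAT IS PROVED (bookkeeping; no renormalisation-group content):
* §1 the TRIVIAL configuration is a fixed point of the Literature's block averaging of record ([Balaban1987RG1] (0.4),
  `BlockAveraging.avgFun ExpMeanLog.expMeanLogSU`) at EVERY level: `iter_blockAvg_one` (`M^k(1) = 1`), by the Literature's
  `T3DescentFibreTower.avgFun_one` ⊕ `expMeanLogSU_E_one` (one step, `exp[mean log 1] = 1`) iterated on an arbitrary `Params`;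
* §2 hence `blockField 𝔟 k y μ ν 1 = 0` at EVERY level (`blockField_one`; the unit's p534572 `blockField_zero` was the level-`0` case),
  the identity exterior lies in NO large-field event of positive threshold (`one_not_mem_largeFieldEvent`), and the influence
  functional vanishes there (`influence_one`, `influenceAt_one`);
* §3 the classical carrier vanishes at the identity exterior on the guard `1 ≤ R` (`carrierCl_one`, from p546887 `classicalResponse_one`);
* §4 THE DIRICHLET RATE LAW `DirichletRate C₁ A₀ β₁ ℓ₁ p`: on the guard `β ≥ β₁`, `1 ≤ R`, `R·uRec β ≤ ℓ₁`, the centre-plane mean of the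
  COLD-WALL cube kernel (identity exterior, side `2R+3`) is within `C₁A₀/R⁴` of the reference value `p q β` — an EXTERIOR-FREE
  statement.  It is FORCED by the flag-free split (`dirichletRate_of_pureSplitCl`), by (split-cl) at ANY tempering with positive
  thresholds (`dirichletRate_of_splitCl`), hence by `PureSplitClSU2`, by `BackgroundFieldBoundedSU2`, and by `BackgroundFieldSU2`-data
  with positive thresholds (`dirichletRateSU2_of_…`); and it PINS the reference values: two admissible `p, p'` differ by at most
  `(C₁A₀ + C₁'A₀')/R⁴` at every admissible `R` (`abs_sub_le_of_dirichletRate`) — so in every (split) the ∃-quantified `p q β` is the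
  cold-wall mean up to `O(R_max⁻⁴)`, `R_max = ℓ₁/uRec β`.

HONEST READING.  (DR) is WEAK — at one loop the cold-wall (Dirichlet) shift of the centre plaquette is `≍ c/(βR⁴)` (dimension 4 of
`tr F²`; the LEAD g9's lattice-Maxwell anchor j285022), inside `C₁A₀/R⁴` as soon as `β₁ ≳ c/(C₁A₀)`; it is recorded as the exterior-free
floor every (split)-type stub stands on and as the typed meaning of the reference values `p`, not as a refutation lever.  Nothing here
asserts (split-cl), (GD), (DR) itself or anything of E0′; not a gap claim, not Clay.
-/

set_option autoImplicit false

noncomputable section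

open MeasureTheory Filter Topology Finset
open Literature.MathematicalPhysics.QuantumFieldTheory (GaugeConfig LatticeRep)
open Literature.MathematicalPhysics.QuantumFieldTheory.Balaban1983to89
open Literature.MathematicalPhysics.QuantumLattice
open Summit.QuantumFields.YangMills.Cruxes.OSLegsFromFemtoAndGap.DlrCollarTransfer
open Summit.QuantumFields.YangMills.Cruxes.UVSeamRec.ClassicalResponse
open Summit.QuantumFields.YangMills.Cruxes.UVSeamRec.PolymerData
open Summit.QuantumFields.YangMills.Cruxes.UVSeamRec.TemperedResponse

namespace Summit.QuantumFields.YangMills.Cruxes.UVSeamRec.PolymerData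

/-! ## §1 The trivial configuration is a fixed point of Bałaban's block averaging of record -/

section Averaging

open BlockAveraging ExpMeanLog T3DescentFibreTower

variable {P : Params} {N : ℕ} [NeZero N]

/-- **`M^k(1) = 1` at every level `k`, on every `Params`**: the trivial configuration is a fixed point of Bałaban's block averaging of
record (one step: the Literature's `T3DescentFibreTower.avgFun_one` with `expMeanLogSU_E_one`). [folklore] -/
theorem iter_blockAvg_one (k : ℕ) :
    Averaging.iter (P := P) (fun _ => blockAvg (expMeanLogSU (n := Fin N))) k
      (1 : GaugeField P 0 (Matrix.specialUnitaryGroup (Fin N) ℂ)) = 1 := by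
  induction k with
  | zero => rfl
  | succ k ih =>
    show (blockAvg (expMeanLogSU (n := Fin N))).avg
        (Averaging.iter (P := P) (fun _ => blockAvg (expMeanLogSU (n := Fin N))) k 1) = 1
    rw [ih, blockAvg_avg]
    exact avgFun_one (expMeanLogSU (n := Fin N)) expMeanLogSU_E_one

end Averaging

/-! ## §2 The identity exterior is never flagged at positive thresholds -/

section Identity

variable {N : ℕ} [NeZero N]

/-- `Ū^k(1) = 1` for the unit's block average of record on the chart torus. -/
theorem blockAvgIter_one (𝔟 : BlockSize) (k : ℕ) :
    blockAvgIter (N := N) 𝔟 k (1 : GaugeField (chartParams 𝔟 k) 0 (Matrix.specialUnitaryGroup (Fin N) ℂ)) = 1 :=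
  iter_blockAvg_one k

/-- **THE IDENTITY EXTERIOR HAS ZERO BLOCK FIELD AT EVERY LEVEL**: `blockField 𝔟 k y μ ν 1 = 0` (the chart of `1` is `1`, `M^k(1) = 1`,
`1(∂p) = 1`, `reTr 1 = 1`). -/
theorem blockField_one (𝔟 : BlockSize) (k : ℕ) (y : Fin 4 → ℤ) (μ ν : Fin 4) (h : μ < ν) :
    blockField (N := N) 𝔟 k y μ ν h (1 : LGConfig 4 (Matrix.specialUnitaryGroup (Fin N) ℂ)) = 0 := by
  unfold blockField
  have hc : ofConfig (P := chartParams 𝔟 k) (j := 0)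
      (chart (chartOrigin 𝔟 k y) (1 : LGConfig 4 (Matrix.specialUnitaryGroup (Fin N) ℂ))) = 1 := by
    funext b; rfl
  rw [hc, blockAvgIter_one]
  have hp : GaugeField.plaqHol (1 : GaugeField (chartParams 𝔟 k) k (Matrix.specialUnitaryGroup (Fin N) ℂ))
      (centralPlaq 𝔟 k μ ν h) = 1 := by
    show (1 : Matrix.specialUnitaryGroup (Fin N) ℂ) * 1 * 1⁻¹ * 1⁻¹ = 1
    simp
  rw [hp, GaugeGroup.reTr_one, sub_self]

/-- At a positive threshold the identity exterior is NOT in the large-field event of any polymer. -/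
theorem one_not_mem_largeFieldEvent (𝔟 : BlockSize) {ε : ℝ} (hε : 0 < ε) (γ : Polymer) :
    (1 : LGConfig 4 (Matrix.specialUnitaryGroup (Fin N) ℂ)) ∉ largeFieldEvent (N := N) 𝔟 ε γ := by
  show ¬ ε ≤ blockField (N := N) 𝔟 γ.k γ.y γ.μ γ.ν γ.hμν 1
  rw [blockField_one]
  exact not_le.2 hε

/-- **At positive thresholds the influence functional vanishes at the identity exterior** (every tempering of the architecture
leaves the identity exterior untempered). -/
theorem influence_one (𝔟 : BlockSize) {ε : ℕ → ℝ} (hε : ∀ k, 0 < ε k) (kmax R : ℕ) (x : Fin 4 → ℤ) :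
    influence (N := N) 𝔟 ε kmax R x (1 : LGConfig 4 (Matrix.specialUnitaryGroup (Fin N) ℂ)) = 0 := by
  unfold influence
  refine Finset.sum_eq_zero fun γ _ => ?_
  rw [Set.indicator_of_notMem (one_not_mem_largeFieldEvent (N := N) 𝔟 (hε γ.k) γ), mul_zero]

/-- `influenceAt … 1 = 0` at positive thresholds. -/
theorem influenceAt_one (𝔟 : BlockSize) {ε : ℝ → ℕ → ℝ} (hε : ∀ β k, 0 < ε β k) (kmax : ℝ → ℕ → ℕ) (β : ℝ) (R : ℕ)
    (q : Fin 4 × Fin 4) (x : Fin 4 → ℤ) :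
    influenceAt (N := N) 𝔟 ε kmax β R q x (1 : LGConfig 4 (Matrix.specialUnitaryGroup (Fin N) ℂ)) = 0 := by
  rw [influenceAt_eq]
  exact influence_one (N := N) 𝔟 (hε β) (kmax β R) R x

end Identity

end Summit.QuantumFields.YangMills.Cruxes.UVSeamRec.PolymerData

namespace Summit.QuantumFields.YangMills.Cruxes.UVSeamRec.ClassicalResponse

/-! ## §3 The classical carrier vanishes at the identity exterior -/

section Carrier

variable {G : Type} [Group G] [TopologicalSpace G] [IsTopologicalGroup G] [CompactSpace G]
  [MeasurableSpace G] [BorelSpace G] (r : LatticeRep G)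

omit [BorelSpace G] in
/-- `carrierCl r C 1 β R q x 1 = 0` (the centre of the cube of side `2R+3` is at depth `R + 2 ≥ 2`; p546887 `classicalResponse_one`).
[folklore] -/
theorem carrierCl_one (C β : ℝ) (R : ℕ) (q : Fin 4 × Fin 4) (hq : q.1 < q.2) (x : Fin 4 → ℤ) :
    carrierCl r C 1 β R q x (1 : LGConfig 4 G) = 0 := by
  unfold carrierCl
  rw [classicalResponse_one (r := r) q hq (by rw [depth_centred]; omega) one_pos le_rfl, mul_zero]

end Carrier

/-! ## §4 The Dirichlet rate law: the exterior-free floor of every (split)-type statement -/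

section Dirichlet

/-- **(DR) THE DIRICHLET RATE LAW** at kernel constant `C₁`, tolerance `A₀`, on the guard `β ≥ β₁`, `1 ≤ R`, `R·uRec β ≤ ℓ₁`: the
centre-plane mean of the COLD-WALL cube kernel (identity exterior, cube of side `2R+3` around `x`) is within `C₁A₀/R⁴` of the
reference value, `(R⁴/C₁)|kerE(𝟙)(plane q x) − p q β| ≤ A₀`.  Exterior-free; translation-invariant in `x` (stated for all `x`). -/
def DirichletRate (C₁ A₀ β₁ ℓ₁ : ℝ) (p : Fin 4 × Fin 4 → ℝ → ℝ) : Prop :=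
  ∀ β : ℝ, β₁ ≤ β → ∀ R : ℕ, 1 ≤ R → (R : ℝ) * Transport.uRec β ≤ ℓ₁ →
    ∀ (q : Fin 4 × Fin 4) (x : Fin 4 → ℤ), q.1 < q.2 →
      (R : ℝ) ^ 4 / C₁ * |kerE (Matrix.specialUnitaryGroup (Fin 2) ℂ) (fundamentalLatticeRep 2) β (fun k => x k - (R + 1)) (2 * R + 3)
        (1 : LGConfig 4 (Matrix.specialUnitaryGroup (Fin 2) ℂ))
        (plane (Matrix.specialUnitaryGroup (Fin 2) ℂ) (fundamentalLatticeRep 2) q x) - p q β| ≤ A₀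

/-- **(DR) AT `SU(2)`, PACKAGED** with the side conditions of (BF)/`PureSplitClSU2`: some `C₁ > 0`, `A₀ ≥ 0`, `ℓ₁ > 0`, bounded `p`. -/
def DirichletRateSU2 : Prop :=
  ∃ (C₁ A₀ P₀ β₁ ℓ₁ : ℝ) (p : Fin 4 × Fin 4 → ℝ → ℝ),
    0 < C₁ ∧ 0 ≤ A₀ ∧ 0 < ℓ₁ ∧ (∀ q β, |p q β| ≤ P₀) ∧ DirichletRate C₁ A₀ β₁ ℓ₁ p

/-- **The flag-free split forces (DR)** (evaluate at the identity exterior: the classical carrier vanishes there). [folklore] -/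
theorem dirichletRate_of_pureSplitCl {C C₁ A₀ β₁ ℓ₁ : ℝ} {p : Fin 4 × Fin 4 → ℝ → ℝ} (h : PureSplitCl C C₁ A₀ β₁ ℓ₁ p) :
    DirichletRate C₁ A₀ β₁ ℓ₁ p := fun β hβ R hR hRa q x hq => by
  have h0 := h β hβ R hR hRa q x hq 1
  rwa [carrierCl_one (fundamentalLatticeRep 2) C β R q hq x, add_zero] at h0

/-- **(split-cl) at ANY tempering with positive thresholds forces (DR)** (the identity exterior is never flagged, §2, and its classical
carrier vanishes, §3). [folklore] -/
theorem dirichletRate_of_splitCl {𝔟 : BlockSize} {ε : ℝ → ℕ → ℝ} (hε : ∀ β k, 0 < ε β k) {kmax : ℝ → ℕ → ℕ}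
    {C C₁ A₀ β₁ ℓ₁ : ℝ} {p : Fin 4 × Fin 4 → ℝ → ℝ} (h : SplitCl 𝔟 ε kmax C C₁ A₀ β₁ ℓ₁ p) :
    DirichletRate C₁ A₀ β₁ ℓ₁ p := fun β hβ R hR hRa q x hq => by
  have h0 := h β hβ R hR hRa q x hq 1
  rwa [carrierCl_one (fundamentalLatticeRep 2) C β R q hq x, influenceAt_one (N := 2) 𝔟 hε kmax β R q x, add_zero, add_zero] at h0

/-- `PureSplitClSU2 → DirichletRateSU2`. [folklore] -/
theorem dirichletRateSU2_of_pureSplitClSU2 (h : PureSplitClSU2) : DirichletRateSU2 := by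
  obtain ⟨C_s, C₁, A₀, P₀, β₁, ℓ₁, p, -, hC₁, hA₀, hℓ₁, hp, hsplit⟩ := h
  exact ⟨C₁, A₀, P₀, β₁, ℓ₁, p, hC₁, hA₀, hℓ₁, hp, dirichletRate_of_pureSplitCl hsplit⟩

/-- `BackgroundFieldBoundedSU2 → DirichletRateSU2` (through p554899 `pureSplitClSU2_of_backgroundFieldBounded`; no sign condition on the
thresholds is needed at bounded cutoff). [folklore] -/
theorem dirichletRateSU2_of_backgroundFieldBounded (h : BackgroundFieldBoundedSU2) : DirichletRateSU2 :=
  dirichletRateSU2_of_pureSplitClSU2 (pureSplitClSU2_of_backgroundFieldBounded h)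

/-- (BF)-data with POSITIVE thresholds force (DR): the curried form over the letters of `BackgroundFieldSU2` (whose ∃ does not record
the sign of the thresholds). [folklore] -/
theorem dirichletRateSU2_of_splitCl_pos {𝔟 : BlockSize} {ε : ℝ → ℕ → ℝ} (hε : ∀ β k, 0 < ε β k) {kmax : ℝ → ℕ → ℕ}
    {C C₁ A₀ P₀ β₁ ℓ₁ : ℝ} {p : Fin 4 × Fin 4 → ℝ → ℝ} (hC₁ : 0 < C₁) (hA₀ : 0 ≤ A₀) (hℓ₁ : 0 < ℓ₁) (hp : ∀ q β, |p q β| ≤ P₀)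
    (h : SplitCl 𝔟 ε kmax C C₁ A₀ β₁ ℓ₁ p) : DirichletRateSU2 :=
  ⟨C₁, A₀, P₀, β₁, ℓ₁, p, hC₁, hA₀, hℓ₁, hp, dirichletRate_of_splitCl hε h⟩

/-- Unnormalised form of (DR): `|kerE(𝟙)(plane q x) − p q β| ≤ C₁A₀/R⁴` on the guard. [folklore] -/
theorem abs_sub_le_of_dirichletRate {C₁ A₀ β₁ ℓ₁ : ℝ} {p : Fin 4 × Fin 4 → ℝ → ℝ} (hC₁ : 0 < C₁)
    (h : DirichletRate C₁ A₀ β₁ ℓ₁ p) {β : ℝ} (hβ : β₁ ≤ β) {R : ℕ} (hR : 1 ≤ R) (hRa : (R : ℝ) * Transport.uRec β ≤ ℓ₁)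
    (q : Fin 4 × Fin 4) (hq : q.1 < q.2) (x : Fin 4 → ℤ) :
    |kerE (Matrix.specialUnitaryGroup (Fin 2) ℂ) (fundamentalLatticeRep 2) β (fun k => x k - (R + 1)) (2 * R + 3)
        (1 : LGConfig 4 (Matrix.specialUnitaryGroup (Fin 2) ℂ))
        (plane (Matrix.specialUnitaryGroup (Fin 2) ℂ) (fundamentalLatticeRep 2) q x) - p q β| ≤ C₁ * A₀ / (R : ℝ) ^ 4 := by
  have h0 := h β hβ R hR hRa q x hq
  have hR4 : (0 : ℝ) < (R : ℝ) ^ 4 := by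
    have : (1 : ℝ) ≤ R := by exact_mod_cast hR
    positivity
  rw [le_div_iff₀ hR4]
  have h1 := mul_le_mul_of_nonneg_left h0 hC₁.le
  calc |kerE (Matrix.specialUnitaryGroup (Fin 2) ℂ) (fundamentalLatticeRep 2) β (fun k => x k - (R + 1)) (2 * R + 3)
          (1 : LGConfig 4 (Matrix.specialUnitaryGroup (Fin 2) ℂ))
          (plane (Matrix.specialUnitaryGroup (Fin 2) ℂ) (fundamentalLatticeRep 2) q x) - p q β| * (R : ℝ) ^ 4
      = C₁ * ((R : ℝ) ^ 4 / C₁ * |kerE (Matrix.specialUnitaryGroup (Fin 2) ℂ) (fundamentalLatticeRep 2) β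
          (fun k => x k - (R + 1)) (2 * R + 3) (1 : LGConfig 4 (Matrix.specialUnitaryGroup (Fin 2) ℂ))
          (plane (Matrix.specialUnitaryGroup (Fin 2) ℂ) (fundamentalLatticeRep 2) q x) - p q β|) := by
        field_simp
    _ ≤ C₁ * A₀ := h1

/-- **(DR) PINS THE REFERENCE VALUES**: two reference maps obeying (DR) (any constants) agree to within `(C₁A₀ + C₁'A₀')/R⁴` at every
`R` admissible for both — so the ∃-quantified `p q β` of every (split)-type statement is the cold-wall centre-plane mean up to
`O(R_max⁻⁴)`. [folklore] -/
theorem abs_sub_le_of_dirichletRate_pair {C₁ C₁' A₀ A₀' β₁ β₁' ℓ₁ ℓ₁' : ℝ} {p p' : Fin 4 × Fin 4 → ℝ → ℝ}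
    (hC₁ : 0 < C₁) (hC₁' : 0 < C₁') (h : DirichletRate C₁ A₀ β₁ ℓ₁ p) (h' : DirichletRate C₁' A₀' β₁' ℓ₁' p')
    {β : ℝ} (hβ : β₁ ≤ β) (hβ' : β₁' ≤ β) {R : ℕ} (hR : 1 ≤ R) (hRa : (R : ℝ) * Transport.uRec β ≤ ℓ₁)
    (hRa' : (R : ℝ) * Transport.uRec β ≤ ℓ₁') (q : Fin 4 × Fin 4) (hq : q.1 < q.2) :
    |p q β - p' q β| ≤ (C₁ * A₀ + C₁' * A₀') / (R : ℝ) ^ 4 := by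
  have h1 := abs_sub_le_of_dirichletRate hC₁ h hβ hR hRa q hq 0
  have h2 := abs_sub_le_of_dirichletRate hC₁' h' hβ' hR hRa' q hq 0
  rw [abs_sub_comm] at h1
  calc |p q β - p' q β| ≤ _ := abs_sub_le _ _ _
    _ ≤ C₁ * A₀ / (R : ℝ) ^ 4 + C₁' * A₀' / (R : ℝ) ^ 4 := add_le_add h1 h2
    _ = (C₁ * A₀ + C₁' * A₀') / (R : ℝ) ^ 4 := by ring

end Dirichlet

end Summit.QuantumFields.YangMills.Cruxes.UVSeamRec.ClassicalResponse

end
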